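import Mathlib
import Literature.Barriers.RiemannHypothesis.JensenPolynomialsKimCorollary

/-!
# Rung R3 «THREE-MODE LAURENT RIGIDITY» of SUB-LINE g22-A «HERMITIAN SLICE» — unfolded, Mathlib-only
# (planner ym-idea-3 g22; crux ⟨stmt-QuantumFields-23035⟩ `F4SubCurvatureDoor.ShortRootRigidity`, registered stub `:146 stub_oddModeRigidity`;
# typed rungs `Cruxes/ShortRootRigidity/Lines/hermitian_slice_rungs.lean`, rung `ThreeModeLaurent`)

Free-hands work of the EXTRA WIDTH seat ym-line-sfw-p2-w4 (gen 25).  Classical one-variable complex analysis (tree folklore `iteratedDeriv_add_eq` /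
`iteratedDeriv_zero_fun` reused from `Literature.Barriers.RiemannHypothesis.JensenPolynomialsKimCorollary`), the sibling of
✓`Theorems/F4SubCurvatureDoorPeriodicEntireRigidity.lean` (period `π/3`, conclusion: constant) with period `2π/3` and conclusion:
three Fourier modes.  With `h = 2π/3` and `q = 𝕢 h z = e^{3iz}` (Mathlib `Function.Periodic.qParam` / `cuspFunction`):

* `g := cuspFunction h G` is complex-differentiable at every `q ≠ 0`, and `G z = g (e^{3iz})`;
* since `Im (invQParam h q) = −log ‖q‖ / 3`, the hypothesis `‖G(φ + iψ)‖ ≤ δ e^{6|ψ|}` (`|ψ| ≥ Ψ(δ)`) reads `‖g q‖ ≤ δ‖q‖⁻²` near `0`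
  and `‖g q‖ ≤ δ‖q‖²` near `∞`;
* so `H q := q · g q` has a removable singularity at `0` (`Complex.differentiableOn_update_limUnder_of_isLittleO`): `H` is ENTIRE with
  growth `o(‖q‖³)`;
* the Cauchy estimate for the third derivative (`Complex.norm_iteratedDeriv_le_of_forall_mem_sphere_norm_le`, radius `R = R₀ + 2‖a‖ + 1`,
  then `δ → 0`) gives `H''' ≡ 0`, hence by the Taylor expansion of an entire function (`Complex.taylorSeries_eq_of_entire'`)
  `H q = A₀ + A₁ q + A₂ q²/2`, i.e. `g q = A₀ q⁻¹ + A₁ + (A₂/2) q`, i.e. `G z = A₁ + (A₂/2) e^{3iz} + A₀ e^{−3iz}`.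

The statement `threeModeLaurent_unfolded` is the rung `ThreeModeLaurent` with its definition unfolded (the Cruxes file is not importable);
the by-name wrapper follows in a separate file once the vocabulary module is in the tree.
HONEST LABEL: one classical rung of an INSURANCE sub-line (g22-A, PASS tier B, unstaffed by design) for `:146`; the sub-line's load-bearing
rungs R2/R4, `:146`, ⟨23035⟩, ⟨23125⟩ and R2d are untouched; no crux, rung of the ladder, leaf or summit is proved; the Yang–Mills mass
gap is NOT proved by this.
-/

noncomputable section

namespace Summit.QuantumFields.YangMills.Theorems.F4SubCurvatureDoorHermitianSlice

open Complex Filter Set Metric Asymptotics Function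
open scoped Topology Real

/-! ## The `q`-variable: `h = 2π/3`, `𝕢 h z = e^{3iz}`, `Im (invQParam h q) = −log ‖q‖ / 3` -/

/-- The period `2π/3` is positive. -/
theorem two_pi_div_three_pos : (0 : ℝ) < 2 * Real.pi / 3 := by positivity

/-- `𝕢_{2π/3} z = e^{3iz}`. -/
theorem qParam_two_pi_div_three (z : ℂ) :
    Periodic.qParam (2 * Real.pi / 3) z = Complex.exp (3 * z * Complex.I) := by
  unfold Periodic.qParam
  congr 1
  have hπ : (Real.pi : ℂ) ≠ 0 := by exact_mod_cast Real.pi_pos.ne'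
  push_cast
  field_simp

/-- `Im (invQParam (2π/3) q) = −log ‖q‖ / 3`. -/
theorem im_invQParam_two_pi_div_three (q : ℂ) :
    (Periodic.invQParam (2 * Real.pi / 3) q).im = -(Real.log ‖q‖) / 3 := by
  rw [Periodic.im_invQParam]
  have hπ : Real.pi ≠ 0 := Real.pi_pos.ne'
  field_simp

/-- The growth hypothesis in the `q`-variable: `‖G (invQParam q)‖ ≤ δ·e^{2|log ‖q‖|}` once `|log ‖q‖| ≥ 3Ψ`. -/
theorem norm_comp_invQParam_le_of_growth {G : ℂ → ℂ} {δ Ψ : ℝ}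
    (hG : ∀ φ ψ : ℝ, Ψ ≤ |ψ| → ‖G (φ + ψ * Complex.I)‖ ≤ δ * Real.exp (6 * |ψ|))
    {q : ℂ} (hq : 3 * Ψ ≤ |Real.log ‖q‖|) :
    ‖G (Periodic.invQParam (2 * Real.pi / 3) q)‖ ≤ δ * Real.exp (2 * |Real.log ‖q‖|) := by
  set z := Periodic.invQParam (2 * Real.pi / 3) q with hz
  have him : |z.im| = |Real.log ‖q‖| / 3 := by
    rw [im_invQParam_two_pi_div_three, abs_div, abs_neg, abs_of_pos (by norm_num : (0:ℝ) < 3)]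
  have hψ : Ψ ≤ |z.im| := by rw [him]; linarith
  have h := hG z.re z.im hψ
  rw [Complex.re_add_im] at h
  have e6 : 6 * |z.im| = 2 * |Real.log ‖q‖| := by rw [him]; ring
  rwa [e6] at h

/-- `e^{2|log r|} = r⁻¹ ^ 2` for `0 < r < 1`. -/
theorem exp_two_mul_abs_log_of_lt_one {r : ℝ} (hr : 0 < r) (hr1 : r < 1) :
    Real.exp (2 * |Real.log r|) = r⁻¹ ^ 2 := by
  have hlogneg : Real.log r < 0 := Real.log_neg hr hr1
  rw [abs_of_neg hlogneg, show 2 * -Real.log r = (-Real.log r) + (-Real.log r) by ring, Real.exp_add, Real.exp_neg,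
    Real.exp_log hr, sq]

/-- `e^{2|log r|} = r ^ 2` for `1 ≤ r`. -/
theorem exp_two_mul_abs_log_of_one_le {r : ℝ} (hr1 : 1 ≤ r) :
    Real.exp (2 * |Real.log r|) = r ^ 2 := by
  have hr : 0 < r := lt_of_lt_of_le one_pos hr1
  rw [abs_of_nonneg (Real.log_nonneg hr1), show 2 * Real.log r = Real.log r + Real.log r by ring, Real.exp_add,
    Real.exp_log hr, sq]

/-- An entire function whose third derivative vanishes identically is a quadratic polynomial (Taylor at `0`). -/
theorem eq_quadratic_of_iteratedDeriv_three_eq_zero {H : ℂ → ℂ} (hH : Differentiable ℂ H)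
    (hD3 : ∀ a : ℂ, iteratedDeriv 3 H a = 0) (q : ℂ) :
    H q = H 0 + deriv H 0 * q + iteratedDeriv 2 H 0 / 2 * q ^ 2 := by
  have hD3fun : iteratedDeriv 3 H = 0 := by
    funext a
    exact hD3 a
  have hDn : ∀ n, 3 ≤ n → iteratedDeriv n H 0 = 0 := by
    intro n hn
    obtain ⟨k, rfl⟩ := Nat.exists_eq_add_of_le hn
    rw [Literature.Barriers.RiemannHypothesis.iteratedDeriv_add_eq H 3 k, hD3fun,
      Literature.Barriers.RiemannHypothesis.iteratedDeriv_zero_fun]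
    rfl
  have hs := Complex.taylorSeries_eq_of_entire' (c := 0) (z := q) hH
  rw [tsum_eq_sum (s := Finset.range 3) (fun n hn => by
    have h3 : 3 ≤ n := by simpa using hn
    rw [hDn n h3]; simp)] at hs
  simp only [Finset.sum_range_succ, Finset.sum_range_zero, sub_zero, Nat.factorial, iteratedDeriv_zero,
    iteratedDeriv_one] at hs
  rw [← hs]
  push_cast
  ring

/-! ## The rung, unfolded -/

/-- ★ **R3 «THREE-MODE LAURENT RIGIDITY» (unfolded)**: an entire `2π/3`-periodic function `G` with `‖G(φ+iψ)‖ = o(e^{6|ψ|})`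
(uniformly in `φ`) is a three-mode trigonometric polynomial `c₀ + c₁ e^{3iz} + c₂ e^{−3iz}`. -/
theorem threeModeLaurent_unfolded (G : ℂ → ℂ) (hG : Differentiable ℂ G)
    (hper : ∀ z : ℂ, G (z + ((2 * Real.pi / 3 : ℝ) : ℂ)) = G z)
    (hgrowth : ∀ δ : ℝ, 0 < δ → ∃ Ψ : ℝ, ∀ φ ψ : ℝ, Ψ ≤ |ψ| → ‖G (φ + ψ * Complex.I)‖ ≤ δ * Real.exp (6 * |ψ|)) :
    ∃ c₀ c₁ c₂ : ℂ, ∀ z : ℂ,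
      G z = c₀ + c₁ * Complex.exp (3 * z * Complex.I) + c₂ * Complex.exp (-(3 * z * Complex.I)) := by
  have hh : (0 : ℝ) < 2 * Real.pi / 3 := two_pi_div_three_pos
  have hperiodic : Periodic G ((2 * Real.pi / 3 : ℝ) : ℂ) := fun z => hper z
  -- the cusp function `g`, kept opaque behind an equation
  obtain ⟨g, hg_def⟩ : ∃ g : ℂ → ℂ, g = Periodic.cuspFunction (2 * Real.pi / 3) G := ⟨_, rfl⟩
  -- (1) `g` is differentiable away from `0`, `g q = G (invQParam q)` there, and `G z = g (𝕢 z)`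
  have hdiff_ne : ∀ q : ℂ, q ≠ 0 → DifferentiableAt ℂ g q := by
    intro q hq
    rw [hg_def, ← Periodic.qParam_right_inv hh.ne' hq]
    exact Periodic.differentiableAt_cuspFunction hh.ne' hperiodic (hG _)
  have hg_eq : ∀ q : ℂ, q ≠ 0 → g q = G (Periodic.invQParam (2 * Real.pi / 3) q) := fun q hq => by
    rw [hg_def, Periodic.cuspFunction_eq_of_nonzero _ _ hq]
  have hG_eq : ∀ z : ℂ, G z = g (Periodic.qParam (2 * Real.pi / 3) z) := fun z => by
    rw [hg_def, Periodic.eq_cuspFunction hh.ne' hperiodic z]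
  -- (2) growth of `g` near `0` and near `∞`
  have hg_small : ∀ δ : ℝ, 0 < δ → ∃ r₀ : ℝ, 0 < r₀ ∧ ∀ q : ℂ, q ≠ 0 → ‖q‖ < r₀ → ‖g q‖ ≤ δ * ‖q‖⁻¹ ^ 2 := by
    intro δ hδ
    obtain ⟨Ψ, hΨ⟩ := hgrowth δ hδ
    refine ⟨min 1 (Real.exp (-(3 * |Ψ|))), lt_min one_pos (Real.exp_pos _), fun q hq0 hqr => ?_⟩
    have hqpos : 0 < ‖q‖ := norm_pos_iff.2 hq0
    have hq1 : ‖q‖ < 1 := lt_of_lt_of_le hqr (min_le_left _ _)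
    have hqe : ‖q‖ < Real.exp (-(3 * |Ψ|)) := lt_of_lt_of_le hqr (min_le_right _ _)
    have hlogneg : Real.log ‖q‖ < 0 := Real.log_neg hqpos hq1
    have hlog : Real.log ‖q‖ < -(3 * |Ψ|) := by
      rw [← Real.exp_lt_exp, Real.exp_log hqpos]; exact hqe
    have hΨ' : 3 * Ψ ≤ |Real.log ‖q‖| := by
      rw [abs_of_neg hlogneg]; linarith [le_abs_self Ψ]
    have hb := norm_comp_invQParam_le_of_growth hΨ hΨ'
    rw [exp_two_mul_abs_log_of_lt_one hqpos hq1] at hb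
    rwa [hg_eq q hq0]
  have hg_large : ∀ δ : ℝ, 0 < δ → ∃ R₀ : ℝ, 0 < R₀ ∧ ∀ q : ℂ, R₀ ≤ ‖q‖ → ‖g q‖ ≤ δ * ‖q‖ ^ 2 := by
    intro δ hδ
    obtain ⟨Ψ, hΨ⟩ := hgrowth δ hδ
    refine ⟨max 1 (Real.exp (3 * |Ψ|)), lt_max_of_lt_left one_pos, fun q hq => ?_⟩
    have hq1 : 1 ≤ ‖q‖ := le_trans (le_max_left _ _) hq
    have hqpos : 0 < ‖q‖ := lt_of_lt_of_le one_pos hq1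
    have hq0 : q ≠ 0 := norm_pos_iff.1 hqpos
    have hlog : 3 * |Ψ| ≤ Real.log ‖q‖ := by
      rw [← Real.exp_le_exp, Real.exp_log hqpos]; exact le_trans (le_max_right _ _) hq
    have hΨ' : 3 * Ψ ≤ |Real.log ‖q‖| := by
      rw [abs_of_nonneg (Real.log_nonneg hq1)]; linarith [le_abs_self Ψ]
    have hb := norm_comp_invQParam_le_of_growth hΨ hΨ'
    rw [exp_two_mul_abs_log_of_one_le hq1] at hb
    rwa [hg_eq q hq0]
  -- (3) `q ↦ q · g q` has a removable singularity at `0`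
  have hdiff0 : DifferentiableOn ℂ (fun q : ℂ => q * g q) (univ \ {0}) := by
    intro q hq
    have hq0 : q ≠ 0 := by simpa using hq
    exact (differentiableAt_id.mul (hdiff_ne q hq0)).differentiableWithinAt
  have ho : (fun z : ℂ => (fun q : ℂ => q * g q) z - (fun q : ℂ => q * g q) 0) =o[𝓝[≠] (0:ℂ)]
      fun z : ℂ => (z - 0)⁻¹ := by
    simp only [zero_mul, sub_zero]
    refine isLittleO_iff.2 fun δ hδ => ?_
    obtain ⟨r₀, hr₀, hr⟩ := hg_small δ hδ
    have hmem : {q : ℂ | q ≠ 0 ∧ ‖q‖ < r₀} ∈ 𝓝[≠] (0:ℂ) := by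
      have : ball (0:ℂ) r₀ ∈ 𝓝 (0:ℂ) := ball_mem_nhds _ hr₀
      filter_upwards [self_mem_nhdsWithin, mem_nhdsWithin_of_mem_nhds this] with q hq hq'
      exact ⟨hq, by simpa using hq'⟩
    filter_upwards [hmem] with q hq
    obtain ⟨hq0, hqr⟩ := hq
    have hqpos : 0 < ‖q‖ := norm_pos_iff.2 hq0
    have hqne : ‖q‖ ≠ 0 := hqpos.ne'
    rw [norm_mul, norm_inv]
    calc ‖q‖ * ‖g q‖ ≤ ‖q‖ * (δ * ‖q‖⁻¹ ^ 2) := by gcongr; exact hr q hq0 hqr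
      _ = δ * ‖q‖⁻¹ := by field_simp
  obtain ⟨H, hH_def⟩ : ∃ H : ℂ → ℂ,
      H = update (fun q : ℂ => q * g q) 0 (limUnder (𝓝[≠] (0:ℂ)) (fun q : ℂ => q * g q)) := ⟨_, rfl⟩
  have hH : Differentiable ℂ H := by
    rw [hH_def]
    exact differentiableOn_univ.1
      (Complex.differentiableOn_update_limUnder_of_isLittleO (univ_mem : (univ : Set ℂ) ∈ 𝓝 (0:ℂ)) hdiff0 ho)
  have hH_eq : ∀ q : ℂ, q ≠ 0 → H q = q * g q := fun q hq => by
    rw [hH_def, update_of_ne hq]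
  -- (4) growth of `H` at `∞`: `‖H q‖ ≤ δ ‖q‖³` for `‖q‖ ≥ R₀(δ)`
  have hH_large : ∀ δ : ℝ, 0 < δ → ∃ R₀ : ℝ, 0 < R₀ ∧ ∀ q : ℂ, R₀ ≤ ‖q‖ → ‖H q‖ ≤ δ * ‖q‖ ^ 3 := by
    intro δ hδ
    obtain ⟨R₀, hR₀, hR⟩ := hg_large δ hδ
    refine ⟨R₀, hR₀, fun q hq => ?_⟩
    have hqpos : 0 < ‖q‖ := lt_of_lt_of_le hR₀ hq
    have hq0 : q ≠ 0 := norm_pos_iff.1 hqpos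
    rw [hH_eq q hq0, norm_mul]
    calc ‖q‖ * ‖g q‖ ≤ ‖q‖ * (δ * ‖q‖ ^ 2) := by gcongr; exact hR q hq
      _ = δ * ‖q‖ ^ 3 := by ring
  -- (5) `H''' ≡ 0` by the Cauchy estimate on large circles
  have hD3 : ∀ a : ℂ, iteratedDeriv 3 H a = 0 := by
    intro a
    rw [← norm_eq_zero]
    refine le_antisymm (le_of_forall_pos_le_add fun ε hε => ?_) (norm_nonneg _)
    obtain ⟨R₀, hR₀, hgR⟩ := hH_large (ε / 48) (by positivity)
    set R : ℝ := R₀ + 2 * ‖a‖ + 1 with hR_def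
    have hRpos : 0 < R := by rw [hR_def]; positivity
    have haR : ‖a‖ ≤ R := by rw [hR_def]; linarith [norm_nonneg a]
    have hsph : ∀ q ∈ sphere a R, ‖H q‖ ≤ ε / 48 * (2 * R) ^ 3 := by
      intro q hq
      rw [mem_sphere, dist_eq_norm] at hq
      have hqa : ‖q‖ ≤ R + ‖a‖ := by
        calc ‖q‖ = ‖(q - a) + a‖ := by rw [sub_add_cancel]
          _ ≤ ‖q - a‖ + ‖a‖ := norm_add_le _ _
          _ = R + ‖a‖ := by rw [hq]
      have hqR : R₀ ≤ ‖q‖ := by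
        have : R - ‖a‖ ≤ ‖q‖ := by
          have hs := norm_sub_le q a
          linarith
        rw [hR_def] at this; linarith [norm_nonneg a]
      calc ‖H q‖ ≤ ε / 48 * ‖q‖ ^ 3 := hgR q hqR
        _ ≤ ε / 48 * (2 * R) ^ 3 := by gcongr; linarith
    have hC := Complex.norm_iteratedDeriv_le_of_forall_mem_sphere_norm_le 3 hRpos hH.diffContOnCl hsph
    have h6 : ((3 : ℕ).factorial : ℝ) = 6 := by norm_num [Nat.factorial]
    rw [h6] at hC
    have : 6 * (ε / 48 * (2 * R) ^ 3) / R ^ 3 = ε := by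
      field_simp
      ring
    linarith [norm_nonneg (iteratedDeriv 3 H a)]
  -- (6) Taylor: `H q = A₀ + A₁ q + (A₂/2) q²`; conclude through `G z = g (𝕢 z) = (𝕢 z)⁻¹ H (𝕢 z)`
  refine ⟨deriv H 0, iteratedDeriv 2 H 0 / 2, H 0, fun z => ?_⟩
  have hq0 : Periodic.qParam (2 * Real.pi / 3) z ≠ 0 := Periodic.qParam_ne_zero _
  have hgq : g (Periodic.qParam (2 * Real.pi / 3) z)
      = (Periodic.qParam (2 * Real.pi / 3) z)⁻¹ * H (Periodic.qParam (2 * Real.pi / 3) z) := by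
    rw [hH_eq _ hq0, ← mul_assoc, inv_mul_cancel₀ hq0, one_mul]
  rw [hG_eq z, hgq, eq_quadratic_of_iteratedDeriv_three_eq_zero hH hD3, qParam_two_pi_div_three,
    ← Complex.exp_neg]
  have hE : Complex.exp (-(3 * z * Complex.I)) * Complex.exp (3 * z * Complex.I) = 1 := by
    rw [← Complex.exp_add, neg_add_cancel, Complex.exp_zero]
  have hE2 : Complex.exp (-(3 * z * Complex.I)) * Complex.exp (3 * z * Complex.I) ^ 2
      = Complex.exp (3 * z * Complex.I) := by
    rw [sq, ← mul_assoc, hE, one_mul]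
  linear_combination (deriv H 0) * hE + (iteratedDeriv 2 H 0 / 2) * hE2

end Summit.QuantumFields.YangMills.Theorems.F4SubCurvatureDoorHermitianSlice

end
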